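import Summits.ResolutionOfSingularities.ResolutionOfSingularities.Theorems.JetCutClasses
import HarnessLib

/-!
# JetCutKernels — decomp-res node «JetCut» (lens-2 g15 rev 5), file 1/2 of `JetCutKernels`

Content VERBATIM from the decomp-res lens-2 file `HOME/decomp-res-lens-2/g15/JetCut.lean` rev 5 (pin 9f53e5ca =
`parts/JetCut-rev5-9f53e5ca.lean`, 7 495 l;
HOME = run/shared/lean/pub/decomp-res; CRITIC-LEDGER rows 109 / 115 / 120 / 121 / 122 / 127 / 133 CLEARED; landing
order INBOX :231; the critic's
HYGIENE-landing.md h1–h11 applied — DOCSTRING-ONLY).  The lens's blocks RESTATED VERBATIM from lens-2 g12 / g13 /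
g14 (§R / §R13 / §R14) are DELETED:
they are the tree's `RelativeDeltaCut*` / `CurveLeafExit*` / `PinchCut*` modules (namespaces `RelativeDeltaCut`,
`CurveLeafExit`, `PinchCut`, opened;
the lens's `CurveLeafExitRestated.x` / `PinchCutRestated.x` are cited as `CurveLeafExit.x` / `PinchCut.x`, the three
pointwise engine edges of g12 as
`RelativeDeltaCut.x`).  Namespace `…Theorems.JetCut` (the lens's `Theses.JetCut` is gate-reserved), sub-namespaces
`Tame` / `Wide` / `Broad` / `Vast`
as in the lens; file split only (tree files ≤ 400 lines): sections, variables and every declaration exactly as in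
the lens, the long rev-0/1 prose
lives in HOME/decomp-res-lens-2/g15/NODE-g15.md §ARCHIVE-A (not in the tree).  Node files, in import order:
`JetCutJetKernels`, `JetCutPoint`, `JetCutClasses`, `JetCutKernels`, `JetCutTame`, `JetCutTameClasses`,
`JetCutTameKernels`, `JetCutLadder`, `JetCutWideClasses`, `JetCutWideKernels`, `JetCutMixed`, `JetCutBroadClasses`,
`JetCutBroadKernels`, `JetCutDegenerate`, `JetCutVastClasses`, `JetCutVastKernels`
(each possibly continued `…2`, `…3`), then the wiring `MaxContactCutJetCut*` (in the Theses cone).  All `--supports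
stmt-ResolutionOfSingularities-29273`
(`MaxContactCut.RungOne`); nothing closes 29273 — decided cells carry their engines as hypotheses, and exactly ONE
located-residual aside is booked on
the route for this column (`Vast.VastSpecialRung`, home `JetCutVastClasses`).

§K + the route-free part of §E: pure-logic KERNELS of the jet cut — pointwise exhaustion
`classGE_or_gen_or_jspecial`, projections of a jet-special point, the EXACT cut `seqDimFour_one_iff : SeqDimFour 1 n
⟺ SeqJGen n ∧ SeqJSpec n`, comparison edges with the g14/g13/g12/g11/g10 schemas, isolation / strata / REG–SING
sub-cuts, the ENGINE kernels at a point and the assemblies `jGenRungAt_of_engines` / `jetGenericRung_of_engines`,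
`flatConeExit_of_jetExit` ((J) subsumes (C)) — VERBATIM, 0 sorry.  Everything naming a `MaxContactCut` route item
(`rungOne_iff`, `closes*`, map / refinement edges) is in `MaxContactCutJetCut*`.

Part 1/2 carries: `classGE_or_gen_or_jspecial`, `not_gen_of_isJetSpecialPt`, `isPinchSpecialPt_of_isJetSpecialPt`,
`isLeafSpecialPt_of_isJetSpecialPt`, `isRelSpecialPt_of_isJetSpecialPt`, `isNearSpecialPt_of_isJetSpecialPt`,
`isFaceSpecialPt_of_isJetSpecialPt`, `isDeltaSpecialPt_of_isJetSpecialPt`, `not_isJetSpecialPt_of_isJetCurvePt`,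
`seqDimFour_one_iff`, `seqDimFour_one_of_jgen_jspec`, `seqJGen_of_seqDimFour_one`, `seqJSpec_of_seqDimFour_one`,
`seqDimFour_two_of_seqJGen`, `seqPGen_of_seqJGen`, `seqLGen_of_seqJGen`, `seqRGen_of_seqJGen`, `seqNGen_of_seqJGen`,
`seqDGen_of_seqJGen`, `seqJSpec_of_seqPSpec`, `seqJSpec_of_seqLSpec`, `seqJSpec_of_seqRSpec`,
`seqJSpec_of_seqNSpec`, `seqJSpec_of_seqDSpec`, `seqJSpecNonIso_of_seqPSpecNonIso`,
`seqJSpecNonIso_of_seqDSpecNonIso`, `seqJSpecCurve_of_seqPSpecCurve`, `seqJSpecCurve_of_seqLSpecCurve`,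
`seqJSpecCurveReg_of_seqPSpecCurveReg`, `seqJSpec_iff_iso`, `seqJSpec_of_iso`, `seqJSpecNonIso_iff`,
`seqJSpecNonIso_of_strata`, `seqJSpecCurve_iff_reg`, `seqJSpecCurve_of_centres`, `seqJSpec_of_leaves`,
`isCurveExitPt_of_isJetCurvePt`, `isCurveExitPt_of_isConeTailCurvePt`, `jGenRungAt_of_engines`, `jGenRungAt_one`.

(Sources: HunekeSwanson2006 Cor. 5.5.5; CossartJannsenSaito2020 Ch. 2, Thm. 3.6/3.7, Ch. 8; CossartPiltant2008 Prop.
4.2; CossartPiltant2019 Rem. 3.2; Hironaka1964 Ch. III; Hironaka1967; Hironaka1977; Moh1987; Giraud1975.)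
-/

open CategoryTheory AlgebraicGeometry TopologicalSpace IsLocalRing
open Literature.AlgebraicGeometry.Resolution
open Summit.ResolutionOfSingularities.ResolutionOfSingularities.Theorems
open Summit.ResolutionOfSingularities.ResolutionOfSingularities.Theorems.WeakOrderReduction
open Summit.ResolutionOfSingularities.ResolutionOfSingularities.Theorems.DeltaFaceCutClasses
open Summit.ResolutionOfSingularities.ResolutionOfSingularities.Theorems.RelativeDeltaCut
open Summit.ResolutionOfSingularities.ResolutionOfSingularities.Theorems.CurveLeafExit
open Summit.ResolutionOfSingularities.ResolutionOfSingularities.Theorems.PinchCut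

namespace Summit.ResolutionOfSingularities.ResolutionOfSingularities.Theorems.JetCut

section Kernels

variable {n : ℕ}

/-! ## §K  Kernels — pure logic (0 sorry) -/

/-- Pointwise EXHAUSTION: a top point is of class ≥ 2, near-generic, δ-generic, curve-generic, rel-curve-generic,
flat-curve, pinch-curve, cone-curve or jet-curve — or jet-special. [folklore] -/
theorem classGE_or_gen_or_jspecial {k : Type} [Field k] {Y : Scheme.{0}} (g : Y ⟶ Spec (.of k))
    (hY : Scheme.IsRegular Y) (I : Y.IdealSheafData) (n : ℕ) (y : Y) :
    (ClassGE g hY I n 2 y ∨ VeryNearCutClasses.IsNearGenericPt I n y ∨ IsDeltaGenericPt I n y ∨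
        IsCurveGenericPt I n y ∨ IsRelCurveGenericPt I n y ∨ IsFlatCurvePt I n y ∨
        IsPinchCurvePt I n y ∨ IsConeCurvePt I n y ∨ IsJetCurvePt I n y) ∨
      IsJetSpecialPt g hY I n y := by
  rcases PinchCut.classGE_or_gen_or_pspecial g hY I n y with h | h
  · rcases h with h | h | h | h | h | h | h | h
    · exact Or.inl (Or.inl h)
    · exact Or.inl (Or.inr (Or.inl h))
    · exact Or.inl (Or.inr (Or.inr (Or.inl h)))
    · exact Or.inl (Or.inr (Or.inr (Or.inr (Or.inl h))))
    · exact Or.inl (Or.inr (Or.inr (Or.inr (Or.inr (Or.inl h)))))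
    · exact Or.inl (Or.inr (Or.inr (Or.inr (Or.inr (Or.inr (Or.inl h))))))
    · exact Or.inl (Or.inr (Or.inr (Or.inr (Or.inr (Or.inr (Or.inr (Or.inl h)))))))
    · exact Or.inl (Or.inr (Or.inr (Or.inr (Or.inr (Or.inr (Or.inr (Or.inr (Or.inl h))))))))
  · by_cases h9 : IsJetCurvePt I n y
    · exact Or.inl (Or.inr (Or.inr (Or.inr (Or.inr (Or.inr (Or.inr (Or.inr (Or.inr h9))))))))
    · exact Or.inr ⟨h, h9⟩

/-- A jet-special point is in none of the nine decided classes. [folklore] -/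
theorem not_gen_of_isJetSpecialPt {k : Type} [Field k] {Y : Scheme.{0}} {g : Y ⟶ Spec (.of k)}
    {hY : Scheme.IsRegular Y} {I : Y.IdealSheafData} {n : ℕ} {y : Y} (h : IsJetSpecialPt g hY I n y) :
    ¬ (ClassGE g hY I n 2 y ∨ VeryNearCutClasses.IsNearGenericPt I n y ∨ IsDeltaGenericPt I n y ∨
        IsCurveGenericPt I n y ∨ IsRelCurveGenericPt I n y ∨ IsFlatCurvePt I n y ∨
        IsPinchCurvePt I n y ∨ IsConeCurvePt I n y ∨ IsJetCurvePt I n y) := by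
  rintro (hc | hg | hd | hu | hr | hf | hm | hC | hJ)
  · exact h.1.1.1.1.1 hc
  · exact h.1.1.1.1.2 hg
  · exact h.1.1.1.2.1 hd
  · exact h.1.1.1.2.2 hu
  · exact h.1.1.2.1 hr
  · exact h.1.1.2.2 hf
  · exact h.1.2.1 hm
  · exact h.1.2.2 hC
  · exact h.2 hJ

/-- A jet-special point is pinch-special (g14, restated) — projection. [folklore] -/
theorem isPinchSpecialPt_of_isJetSpecialPt {k : Type} [Field k] {Y : Scheme.{0}} {g : Y ⟶ Spec (.of k)}
    {hY : Scheme.IsRegular Y} {I : Y.IdealSheafData} {n : ℕ} {y : Y} (h : IsJetSpecialPt g hY I n y) :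
    IsPinchSpecialPt g hY I n y :=
  h.1

/-- A jet-special point is leaf-special (g13, restated). [folklore] -/
theorem isLeafSpecialPt_of_isJetSpecialPt {k : Type} [Field k] {Y : Scheme.{0}} {g : Y ⟶ Spec (.of k)}
    {hY : Scheme.IsRegular Y} {I : Y.IdealSheafData} {n : ℕ} {y : Y} (h : IsJetSpecialPt g hY I n y) :
    IsLeafSpecialPt g hY I n y :=
  h.1.1

/-- A jet-special point is relatively special (g12). [folklore] -/
theorem isRelSpecialPt_of_isJetSpecialPt {k : Type} [Field k] {Y : Scheme.{0}} {g : Y ⟶ Spec (.of k)}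
    {hY : Scheme.IsRegular Y} {I : Y.IdealSheafData} {n : ℕ} {y : Y} (h : IsJetSpecialPt g hY I n y) :
    IsRelSpecialPt g hY I n y :=
  h.1.1.1

/-- A jet-special point is near-special (g10, tree). [folklore] -/
theorem isNearSpecialPt_of_isJetSpecialPt {k : Type} [Field k] {Y : Scheme.{0}} {g : Y ⟶ Spec (.of k)}
    {hY : Scheme.IsRegular Y} {I : Y.IdealSheafData} {n : ℕ} {y : Y} (h : IsJetSpecialPt g hY I n y) :
    VeryNearCutClasses.IsNearSpecialPt g hY I n y :=
  h.1.1.1.1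

/-- A jet-special point is face-special (g9, tree). [folklore] -/
theorem isFaceSpecialPt_of_isJetSpecialPt {k : Type} [Field k] {Y : Scheme.{0}} {g : Y ⟶ Spec (.of k)}
    {hY : Scheme.IsRegular Y} {I : Y.IdealSheafData} {n : ℕ} {y : Y} (h : IsJetSpecialPt g hY I n y) :
    FaceFormCutClasses.IsFaceSpecialPt g hY I n y :=
  PinchCut.isFaceSpecialPt_of_isPinchSpecialPt h.1

/-- A jet-special point is δ-special (g11, tree). [folklore] -/
theorem isDeltaSpecialPt_of_isJetSpecialPt {k : Type} [Field k] {Y : Scheme.{0}} {g : Y ⟶ Spec (.of k)}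
    {hY : Scheme.IsRegular Y} {I : Y.IdealSheafData} {n : ℕ} {y : Y} (h : IsJetSpecialPt g hY I n y) :
    IsDeltaSpecialPt g hY I n y :=
  PinchCut.isDeltaSpecialPt_of_isPinchSpecialPt h.1

/-- A cone-curve, pinch-curve, flat-curve, … point is NOT jet-special (the located class avoids every decided leaf).
[folklore] -/
theorem not_isJetSpecialPt_of_isJetCurvePt {k : Type} [Field k] {Y : Scheme.{0}} {g : Y ⟶ Spec (.of k)}
    {hY : Scheme.IsRegular Y} {I : Y.IdealSheafData} {n : ℕ} {y : Y} (h : IsJetCurvePt I n y) :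
    ¬ IsJetSpecialPt g hY I n y :=
  fun hs => hs.2 h

/-- **EXACT at each marking**: `SeqDimFour 1 n ⟺ SeqJGen n ∧ SeqJSpec n` (excluded middle on «some top point is
jet-special»). [folklore] -/
theorem seqDimFour_one_iff : SeqDimFour 1 n ↔ SeqJGen n ∧ SeqJSpec n := by
  constructor
  · intro h
    refine ⟨?_, ?_⟩
    · intro p hp k _ _ Y g h1 h2 h3 hY h4 I hord _
      exact h p hp k Y g h1 h2 h3 hY h4 I hord (fun y _ => Or.inl le_rfl)
    · intro p hp k _ _ Y g h1 h2 h3 hY h4 I hord _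
      exact h p hp k Y g h1 h2 h3 hY h4 I hord (fun y _ => Or.inl le_rfl)
  · rintro ⟨hG, hS⟩ p hp k _ _ Y g h1 h2 h3 hY h4 I hord _
    by_cases hex : ∃ y : Y, idealOrder I y = ((n : ℕ) : ℕ∞) ∧ IsJetSpecialPt g hY I n y
    · exact hS p hp k Y g h1 h2 h3 hY h4 I hord hex
    · refine hG p hp k Y g h1 h2 h3 hY h4 I hord ?_
      intro y hy
      rcases classGE_or_gen_or_jspecial g hY I n y with h | h
      · exact h
      · exact absurd ⟨y, hy, h⟩ hex

/-- The two classes at one marking give all data. [folklore] -/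
theorem seqDimFour_one_of_jgen_jspec (hG : SeqJGen n) (hS : SeqJSpec n) : SeqDimFour 1 n :=
  seqDimFour_one_iff.mpr ⟨hG, hS⟩

/-- `SeqJGen n` is `SeqDimFour 1 n` restricted: weaker BY LETTER. [folklore] -/
theorem seqJGen_of_seqDimFour_one (h : SeqDimFour 1 n) : SeqJGen n := (seqDimFour_one_iff.mp h).1

/-- `SeqJSpec n` is `SeqDimFour 1 n` restricted: weaker BY LETTER. [folklore] -/
theorem seqJSpec_of_seqDimFour_one (h : SeqDimFour 1 n) : SeqJSpec n := (seqDimFour_one_iff.mp h).2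

/-- `SeqDimFour 2 n` is `SeqJGen n` restricted. [folklore] -/
theorem seqDimFour_two_of_seqJGen (h : SeqJGen n) : SeqDimFour 2 n := by
  intro p hp k _ _ Y g h1 h2 h3 hY h4 I hord hcls
  exact h p hp k Y g h1 h2 h3 hY h4 I hord (fun y hy => Or.inl (hcls y hy))

/-- g14's decided schema `SeqPGen n` (restated) is `SeqJGen n` restricted (the jet leaf ENLARGES the decided class).
[folklore] -/
theorem seqPGen_of_seqJGen (h : SeqJGen n) : SeqPGen n := by
  intro p hp k _ _ Y g h1 h2 h3 hY h4 I hord hcls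
  refine h p hp k Y g h1 h2 h3 hY h4 I hord ?_
  intro y hy
  rcases hcls y hy with h' | h' | h' | h' | h' | h' | h' | h'
  · exact Or.inl h'
  · exact Or.inr (Or.inl h')
  · exact Or.inr (Or.inr (Or.inl h'))
  · exact Or.inr (Or.inr (Or.inr (Or.inl h')))
  · exact Or.inr (Or.inr (Or.inr (Or.inr (Or.inl h'))))
  · exact Or.inr (Or.inr (Or.inr (Or.inr (Or.inr (Or.inl h')))))
  · exact Or.inr (Or.inr (Or.inr (Or.inr (Or.inr (Or.inr (Or.inl h'))))))
  · exact Or.inr (Or.inr (Or.inr (Or.inr (Or.inr (Or.inr (Or.inr (Or.inl h')))))))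

/-- g13's decided schema `SeqLGen n` (restated) is `SeqJGen n` restricted. [folklore] -/
theorem seqLGen_of_seqJGen (h : SeqJGen n) : SeqLGen n :=
  PinchCut.seqLGen_of_seqPGen (seqPGen_of_seqJGen h)

/-- g12's decided schema `SeqRGen n` (restated; tree `RelativeDeltaCutClasses`) is `SeqJGen n` restricted. [folklore] -/
theorem seqRGen_of_seqJGen (h : SeqJGen n) : SeqRGen n :=
  PinchCut.seqRGen_of_seqPGen (seqPGen_of_seqJGen h)

/-- g10's decided schema `SeqNGen n` (tree) is `SeqJGen n` restricted. [folklore] -/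
theorem seqNGen_of_seqJGen (h : SeqJGen n) : VeryNearCutClasses.SeqNGen n :=
  PinchCut.seqNGen_of_seqPGen (seqPGen_of_seqJGen h)

/-- g11's decided schema `SeqDGen n` (tree) is `SeqJGen n` restricted. [folklore] -/
theorem seqDGen_of_seqJGen (h : SeqJGen n) : SeqDGen n :=
  PinchCut.seqDGen_of_seqPGen (seqPGen_of_seqJGen h)

/-- g14's located schema `SeqPSpec n` (restated) gives `SeqJSpec n` (jet-special ⇒ pinch-special): the located class
SHRINKS by letter. [folklore] -/
theorem seqJSpec_of_seqPSpec (h : SeqPSpec n) : SeqJSpec n := by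
  intro p hp k _ _ Y g h1 h2 h3 hY h4 I hord hex
  obtain ⟨y, hy, hs⟩ := hex
  exact h p hp k Y g h1 h2 h3 hY h4 I hord ⟨y, hy, hs.1⟩

/-- g13's located schema `SeqLSpec n` (restated) gives `SeqJSpec n`. [folklore] -/
theorem seqJSpec_of_seqLSpec (h : SeqLSpec n) : SeqJSpec n :=
  seqJSpec_of_seqPSpec (PinchCut.seqPSpec_of_seqLSpec h)

/-- g12's located schema `SeqRSpec n` (restated) gives `SeqJSpec n`. [folklore] -/
theorem seqJSpec_of_seqRSpec (h : SeqRSpec n) : SeqJSpec n :=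
  seqJSpec_of_seqPSpec (PinchCut.seqPSpec_of_seqRSpec h)

/-- g10's located schema `SeqNSpec n` (tree) gives `SeqJSpec n`. [folklore] -/
theorem seqJSpec_of_seqNSpec (h : VeryNearCutClasses.SeqNSpec n) : SeqJSpec n :=
  seqJSpec_of_seqPSpec (PinchCut.seqPSpec_of_seqNSpec h)

/-- g11's located schema `SeqDSpec n` (tree) gives `SeqJSpec n`. [folklore] -/
theorem seqJSpec_of_seqDSpec (h : SeqDSpec n) : SeqJSpec n :=
  seqJSpec_of_seqPSpec (PinchCut.seqPSpec_of_seqDSpec h)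

/-- g14's NON-ISOLATED column gives this node's (the column SHRINKS by letter). [folklore] -/
theorem seqJSpecNonIso_of_seqPSpecNonIso (h : SeqPSpecNonIso n) : SeqJSpecNonIso n := by
  intro p hp k _ _ Y g h1 h2 h3 hY h4 I hord hex
  obtain ⟨y, hy, hs, hni⟩ := hex
  exact h p hp k Y g h1 h2 h3 hY h4 I hord ⟨y, hy, hs.1, hni⟩

/-- g11's NON-ISOLATED column (tree) gives this node's. [folklore] -/
theorem seqJSpecNonIso_of_seqDSpecNonIso (h : SeqDSpecNonIso n) : SeqJSpecNonIso n :=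
  seqJSpecNonIso_of_seqPSpecNonIso (PinchCut.seqPSpecNonIso_of_seqDSpecNonIso h)

/-- g14's CURVE stratum gives this node's (the stratum SHRINKS by letter). [folklore] -/
theorem seqJSpecCurve_of_seqPSpecCurve (h : SeqPSpecCurve n) : SeqJSpecCurve n := by
  intro p hp k _ _ Y g h1 h2 h3 hY h4 I hord hex
  obtain ⟨y, hy, hs, hni, hcl⟩ := hex
  exact h p hp k Y g h1 h2 h3 hY h4 I hord ⟨y, hy, hs.1, hni, hcl⟩

/-- g13's CURVE stratum (restated) gives this node's (through g14's). [folklore] -/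
theorem seqJSpecCurve_of_seqLSpecCurve (h : SeqLSpecCurve n) : SeqJSpecCurve n :=
  seqJSpecCurve_of_seqPSpecCurve (PinchCut.seqPSpecCurve_of_seqLSpecCurve h)

/-- **g14's REGULAR-CENTRE cell gives this node's** — THE CELL THIS NODE CUTS SHRINKS BY LETTER (the jet-curve points
leave it). [folklore] -/
theorem seqJSpecCurveReg_of_seqPSpecCurveReg (h : SeqPSpecCurveReg n) : SeqJSpecCurveReg n := by
  intro p hp k _ _ Y g h1 h2 h3 hY h4 I hord hex
  obtain ⟨y, hy, hs, hni, hreg⟩ := hex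
  exact h p hp k Y g h1 h2 h3 hY h4 I hord ⟨y, hy, hs.1, hni, hreg⟩

/-- **EXACT isolation sub-cut of the located class**: `SeqJSpec n ⟺ SeqJSpecNonIso n ∧ SeqJSpecIso n`. [folklore] -/
theorem seqJSpec_iff_iso : SeqJSpec n ↔ SeqJSpecNonIso n ∧ SeqJSpecIso n := by
  constructor
  · intro h
    refine ⟨?_, ?_⟩
    · intro p hp k _ _ Y g h1 h2 h3 hY h4 I hord hex
      obtain ⟨y, hy, hs, -⟩ := hex
      exact h p hp k Y g h1 h2 h3 hY h4 I hord ⟨y, hy, hs⟩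
    · intro p hp k _ _ Y g h1 h2 h3 hY h4 I hord hex _
      exact h p hp k Y g h1 h2 h3 hY h4 I hord hex
  · rintro ⟨hN, hI⟩ p hp k _ _ Y g h1 h2 h3 hY h4 I hord hex
    by_cases hni : ∃ y : Y, idealOrder I y = ((n : ℕ) : ℕ∞) ∧ IsJetSpecialPt g hY I n y ∧
        ¬ FaceFormCutClasses.IsIsolatedTop I n y
    · exact hN p hp k Y g h1 h2 h3 hY h4 I hord hni
    · refine hI p hp k Y g h1 h2 h3 hY h4 I hord hex ?_
      intro y hy hs
      by_contra hiso
      exact hni ⟨y, hy, hs, hiso⟩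

/-- The two isolation columns give the located class (`mpr`, by name for probes). [folklore] -/
theorem seqJSpec_of_iso (hN : SeqJSpecNonIso n) (hI : SeqJSpecIso n) : SeqJSpec n :=
  seqJSpec_iff_iso.mpr ⟨hN, hI⟩

/-- **EXACT sub-cut of the NON-ISOLATED column**: `SeqJSpecNonIso n ⟺ SeqJSpecCurve n ∧ SeqJSpecTangle n`. [folklore] -/
theorem seqJSpecNonIso_iff : SeqJSpecNonIso n ↔ SeqJSpecCurve n ∧ SeqJSpecTangle n := by
  constructor
  · intro h
    refine ⟨?_, ?_⟩
    · intro p hp k _ _ Y g h1 h2 h3 hY h4 I hord hex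
      obtain ⟨y, hy, hs, hni, -⟩ := hex
      exact h p hp k Y g h1 h2 h3 hY h4 I hord ⟨y, hy, hs, hni⟩
    · intro p hp k _ _ Y g h1 h2 h3 hY h4 I hord hex _
      exact h p hp k Y g h1 h2 h3 hY h4 I hord hex
  · rintro ⟨hC, hT⟩ p hp k _ _ Y g h1 h2 h3 hY h4 I hord hex
    by_cases hcur : ∃ y : Y, idealOrder I y = ((n : ℕ) : ℕ∞) ∧ IsJetSpecialPt g hY I n y ∧
        ¬ FaceFormCutClasses.IsIsolatedTop I n y ∧ OnCleanCurve I n y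
    · exact hC p hp k Y g h1 h2 h3 hY h4 I hord hcur
    · refine hT p hp k Y g h1 h2 h3 hY h4 I hord hex ?_
      intro y hy hs hni hcl
      exact hcur ⟨y, hy, hs, hni, hcl⟩

/-- The two strata give the non-isolated column (`mpr`, by name for probes). [folklore] -/
theorem seqJSpecNonIso_of_strata (hC : SeqJSpecCurve n) (hT : SeqJSpecTangle n) : SeqJSpecNonIso n :=
  seqJSpecNonIso_iff.mpr ⟨hC, hT⟩

/-- **EXACT sub-cut of the CURVE stratum by the REGULARITY OF THE CENTRE**: `SeqJSpecCurve n ⟺ SeqJSpecCurveReg n ∧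
SeqJSpecCurveSing n`. [folklore] -/
theorem seqJSpecCurve_iff_reg : SeqJSpecCurve n ↔ SeqJSpecCurveReg n ∧ SeqJSpecCurveSing n := by
  constructor
  · intro h
    refine ⟨?_, ?_⟩
    · intro p hp k _ _ Y g h1 h2 h3 hY h4 I hord hex
      obtain ⟨y, hy, hs, hni, hreg⟩ := hex
      exact h p hp k Y g h1 h2 h3 hY h4 I hord
        ⟨y, hy, hs, hni, PinchCut.onCleanCurve_of_onRegularCleanCurve hreg⟩
    · intro p hp k _ _ Y g h1 h2 h3 hY h4 I hord hex _
      exact h p hp k Y g h1 h2 h3 hY h4 I hord hex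
  · rintro ⟨hR, hS⟩ p hp k _ _ Y g h1 h2 h3 hY h4 I hord hex
    by_cases hreg : ∃ y : Y, idealOrder I y = ((n : ℕ) : ℕ∞) ∧ IsJetSpecialPt g hY I n y ∧
        ¬ FaceFormCutClasses.IsIsolatedTop I n y ∧ OnRegularCleanCurve I n y
    · exact hR p hp k Y g h1 h2 h3 hY h4 I hord hreg
    · refine hS p hp k Y g h1 h2 h3 hY h4 I hord hex ?_
      intro y hy hs hni _ hr
      exact hreg ⟨y, hy, hs, hni, hr⟩

/-- The two centre strata give the curve stratum (`mpr`, by name for probes). [folklore] -/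
theorem seqJSpecCurve_of_centres (hR : SeqJSpecCurveReg n) (hS : SeqJSpecCurveSing n) : SeqJSpecCurve n :=
  seqJSpecCurve_iff_reg.mpr ⟨hR, hS⟩

/-- The located class from its four leaves: CURVE-REGULAR, CURVE-SINGULAR, TANGLE, ISO. [folklore] -/
theorem seqJSpec_of_leaves (hR : SeqJSpecCurveReg n) (hS : SeqJSpecCurveSing n) (hT : SeqJSpecTangle n)
    (hI : SeqJSpecIso n) : SeqJSpec n :=
  seqJSpec_of_iso (seqJSpecNonIso_of_strata (seqJSpecCurve_of_centres hR hS) hT) hI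

/-- ENGINE AT A POINT (viii): the NEW engine (J) `JetExit` makes a jet-curve point a curve-exit point OF g12's PORT
(same conclusion shape `PackageExitsOver`). [folklore] -/
theorem isCurveExitPt_of_isJetCurvePt {Y : Scheme.{0}} {I : Y.IdealSheafData} {n : ℕ} {y : Y}
    (hJ : JetExit) (hY : Scheme.IsRegular Y) (hn : 2 ≤ n) (h : IsJetCurvePt I n y) :
    IsCurveExitPt I n y := by
  obtain ⟨η, hηy, hiso, hcurve⟩ := h
  exact ⟨η, hηy, hcurve.1, hiso, hJ Y hY I n hn η hcurve⟩

/-- [rev 1] Under ENGINE (J) alone, every cone-tail-curve point is a curve-exit point: the (CT) sub-class of g14's located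
cell is DECIDED by the one engine and the one port (no new engine, no new port). KERNEL (PROVED). [folklore] -/
theorem isCurveExitPt_of_isConeTailCurvePt {Y : Scheme.{0}} {I : Y.IdealSheafData} {n : ℕ} {y : Y}
    (hJ : JetExit) (hY : Scheme.IsRegular Y) (hn : 2 ≤ n) (h : IsConeTailCurvePt I n y) :
    IsCurveExitPt I n y :=
  isCurveExitPt_of_isJetCurvePt hJ hY hn (isJetCurvePt_of_isConeTailCurvePt hn h)

/-- **THE ENGINES AT WORK (pure logic given the typed pieces)**: the tree engines `VeryNearExit` (g10) and
`DeltaPackageExit` (g11), g12's `UniformCurvePackageExit`, g13's `RelCurvePackageExit` (A) and `NormalConeJumpExit` (B),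
g14's `MonomialPinchExit` (M) and `FlatConeExit` (C), the NEW engine `JetExit` (J), and g12's engine-free port
`CurvePackagePort n` UNCHANGED give `JGenRungAt n` for `n ≥ 2`. [folklore] -/
theorem jGenRungAt_of_engines (hV : VeryNearCutClasses.VeryNearExit) (hD : DeltaPackageExit)
    (hU : UniformCurvePackageExit) (hR : RelCurvePackageExit) (hN : NormalConeJumpExit)
    (hM : MonomialPinchExit) (hC : FlatConeExit) (hJ : JetExit) (hP : CurvePackagePort n) (hn : 2 ≤ n) :
    JGenRungAt n := by
  intro h2 p hp k _ _ Y g hg1 hg2 hg3 hY h4 I hord hcls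
  refine hP h2 p hp k Y g hg1 hg2 hg3 hY h4 I hord ?_
  intro y hy
  rcases hcls y hy with h | h | h | h | h | h | h | h | h
  · exact Or.inl h
  · exact Or.inr (Or.inl (RelativeDeltaCut.isNearExitPt_of_isNearGenericPt hV hY hn h))
  · exact Or.inr (Or.inr (Or.inl (RelativeDeltaCut.isPackageExitPt_of_isDeltaGenericPt hD hY hn hy h)))
  · exact Or.inr (Or.inr (Or.inr (RelativeDeltaCut.isCurveExitPt_of_isCurveGenericPt hU hY hn h)))
  · exact Or.inr (Or.inr (Or.inr (CurveLeafExit.isCurveExitPt_of_isRelCurveGenericPt hR hY hn h)))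
  · exact Or.inr (Or.inr (Or.inr (CurveLeafExit.isCurveExitPt_of_isFlatCurvePt hN hY hn h)))
  · exact Or.inr (Or.inr (Or.inr (PinchCut.isCurveExitPt_of_isPinchCurvePt hM hY hn h)))
  · exact Or.inr (Or.inr (Or.inr (PinchCut.isCurveExitPt_of_isConeCurvePt hC hY hn h)))
  · exact Or.inr (Or.inr (Or.inr (isCurveExitPt_of_isJetCurvePt hJ hY hn h)))

/-- At marking `1` every top point is a contact point (tree port `OrderOneContact`), hence of class ≥ 2: `JGenRungAt 1`
with no blow-up at all. [folklore] -/
theorem jGenRungAt_one (h1 : FaceFormCutClasses.OrderOneContact) : JGenRungAt 1 := by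
  intro h2 p hp k _ _ Y g hg1 hg2 hg3 hY h4 I hord _
  refine h2 p hp k Y g hg1 hg2 hg3 hY h4 I hord ?_
  intro y hy
  exact Or.inr (Or.inl (h1 p hp k Y g hg1 hg2 hg3 hY I y hy))

end Kernels

end Summit.ResolutionOfSingularities.ResolutionOfSingularities.Theorems.JetCut
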